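import Summits.QuantumFields.BalabanUV.T4Continuum.Support.NE9BirthCouplingJunction

/-!
# NE9BirthInsertionUnbounded — the one-block model at a NONNEGATIVE, possibly UNBOUNDED action: holomorphy of the cut-off
Boltzmann block integral on the open right half-plane from `Integrable f` alone, and BOTH one-block (L)-supplier faces of
row NE9 — (i) complex dilation (`T4ComplexDilation.act_dilationAnalytic` / `act_lipschitz` / `stepTransfer_modelV`) and
(iv) insertion ∕ birth (`NE9BirthCouplingTwoPoint.couplingTwoPoint_of_insertion`, `NE9BirthCouplingJunction.hCup_of_insertion`)
— re-derived with the bounded-action binder `hS₀ : ∀ x, |S x| ≤ S₀` REMOVED (cell `pub-balaban`, node U3 ∕ NE9, rung (B)+1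
on a finite T⁴; NE9 formalisation crew `b2b-balaban-t4-ne9-formalise-*`, leaf prover 03; referee `t4/formal/NE9/REFEREE.md`
v1 §3 divergence note DV-3)

HONEST FRAMING (T4-DAG PAGE 1).  Rung (B)+1 on a FIXED finite torus; NOT infinite volume, NOT the mass gap, NOT Clay.  NE9 is
NOT PRINTED and is NOT discharged here.  OUR OWN WORK (Summits side): elementary real∕complex analysis and measure theory on
the ABSTRACT one-block objects of the tree leaf `T4ComplexDilation` (reference measure `μ` carrying the coupling-free
cut-off, coupling-free density `f`, real action density `S` multiplied by the coupling) and on route P3's real-normalised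
activity `actR` ∕ insertion-structured family `insAct`; [folklore] throughout; nothing is asserted about Bałaban's
functionals; spine 0∕9 unchanged.  The manuscripts under audit are named for STRUCTURE only ([Balaban1987RG1] (2.10) p. 267:
in the unscaled fluctuation variables B′ the step's own coupling is the prefactor `t_k = 1∕g_k²` of a NONNEGATIVE quadratic-
plus-higher-order fluctuation action, LINEAR in the exponent; the small-field cut-off (2.9) p. 266 is `t_k`-free).

WHY.  The tree's holomorphy lemma `T4ComplexDilation.hasDerivAt_blockInt` differentiates `w ↦ ∫ f·e^{−wS} dμ` at EVERY
complex `w` and therefore needs `S` BOUNDED on the block (dominating function `‖f‖·S₀·e^{(‖w₀‖+1)S₀}`); every consumer —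
`differentiableOn_act`, `act_dilationAnalytic`, `act_lipschitz`, `stepTransfer_modelV` (face (i)) and route P3's
`hasDerivAt_blockInt_real`, `hasDerivAt_actR`, `couplingTwoPoint_of_insertion`, `hCup_of_insertion` (face (iv)) — inherits
the binder although each of them only ever evaluates the block integral at couplings of POSITIVE real part.  The referee of
the NE9 crew recorded this as DV-3: «a restriction of the insertion model (Bałaban's quadratic actions are unbounded on the
full field space; bounded only after the small-field cut-off) … the instantiation on O-NE9-1 must supply it from the cut-off,
which is where it will bite» — and since the cut-off sits in `μ`∕`f`, not in `S`, a GLOBAL bound `∀ x, |S x| ≤ S₀` is not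
even what the cut-off provides.  For a NONNEGATIVE action none of this is needed: on the half-plane `Re w ≥ ρ > 0` the
derivative integrand obeys `‖f·(−S)·e^{−wS}‖ = ‖f‖·S·e^{−(Re w)S} ≤ ‖f‖·S·e^{−ρS} ≤ ‖f‖·(e·ρ)⁻¹` (route P3's own insertion
weight `NE9BirthInsertion.mul_exp_neg_mul_le`), an integrable dominating function uniform on the ball `|w − w₀| < Re w₀ ∕ 2`.

WHAT IS PROVED (all [folklore]; `S ≥ 0` measurable, `f` integrable — NO bound on `S`).
* §1 `hasDerivAt_blockInt_of_nonneg`: `blockInt μ f S` has derivative `∫ f·(−S)·e^{−w₀S} dμ` at every `w₀` with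
  `0 < Re w₀`; `differentiableOn_blockInt_of_nonneg` on `{w | 0 < Re w}`; real axis `hasDerivAt_blockInt_real_of_nonneg`
  (`r > 0`, derivative = `NE9BirthInsertion.insertion μ f S r`); log-currency `hasDerivAt_blockInt_log_of_nonneg` (ALL `u`,
  since `e^u > 0` — the log-currency face needs no hypothesis on `S` beyond sign and measurability).
* §2 FACE (i) without `hS₀`: `differentiableOn_act_of_nonneg`, `act_dilationAnalytic_of_nonneg`, `act_lipschitz_of_nonneg`,
  `stepTransfer_modelV_of_nonneg` — statements of `T4ComplexDilation` VERBATIM with `hS₀` replaced by `hS0 : ∀ x, 0 ≤ S x`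
  (proofs verbatim, the holomorphy supplier swapped).
* §3 FACE (iv) without `hS₀`: `hasDerivAt_actR_of_nonneg`, `couplingTwoPoint_of_insertion_of_nonneg` — route P3's statements
  VERBATIM minus `hS₀` (they already assume `S ≥ 0`); proofs verbatim from `NE9BirthCouplingTwoPoint` with the derivative
  supplier swapped.
* §4 THE JUNCTION without `hS₀`: **`hCup_of_insertion_of_nonneg`** — the conclusion is LITERALLY the COUPLING TWO-POINT clause
  `hCup` of `NE9LastCouplingBridge.norm_newTerm_sub_le_of_couplingTwoPoint` for `act := insAct G nv A μ f S`,
  `n := insMajorant G θ nv N₀`, `clip := fun _ => t₀⁻¹` (route P3's `hCup_of_insertion`, same constants), from: blocks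
  positive definite, densities integrable on admissible configurations, `S` measurable and NONNEGATIVE, window couplings
  `≥ t₀ > 0`, `0 < θ < 1`, `absAct ≤ N₀` on the dilated range — and nothing else.
WHAT IS NOT HERE: anything about Bałaban's (2.14) activities (skeleton item O2 ∕ O-NE9-1); the KP absorption of the volume
factor; faces (ii)∕(iii)∕(v) (untouched).  «(L) face (iv) supplied by route P3; binder hS₀ removed» — never «NE9 proved».

References (STRUCTURE only): T. Bałaban, CMP **109** (1987) 249–301 [Balaban1987RG1], (2.9)–(2.14) pp. 266–268;
T. Bałaban, CMP **116** (1988) 1–22 [Balaban1988RG2Cluster], (2.15) p. 15, (2.30) p. 18, Lemma 3 (2.38) p. 20.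
-/

noncomputable section

namespace Summit.QuantumFields.BalabanUV.T4Continuum.NE9BirthInsertionUnbounded

open MeasureTheory Complex Set Metric
open Literature.MathematicalPhysics.QuantumFieldTheory.Balaban1983to89
open Literature.MathematicalPhysics.QuantumFieldTheory.Balaban1983to89.T4OutputRate
open Literature.MathematicalPhysics.QuantumFieldTheory.Balaban1983to89.T4CouplingAnalyticity
open Literature.MathematicalPhysics.QuantumFieldTheory.Balaban1983to89.T4HistoryLipschitzActivity (ClusterGeom)
open Literature.MathematicalPhysics.QuantumFieldTheory.Balaban1983to89.T4ComplexDilation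
open Summit.QuantumFields.BalabanUV.T4Continuum.NE9BirthInsertion
open Summit.QuantumFields.BalabanUV.T4Continuum.NE9BirthCouplingTwoPoint
open Summit.QuantumFields.BalabanUV.T4Continuum.NE9BirthCouplingJunction

/-! ## §1 Holomorphy of the block integral on the right half-plane for a nonnegative, possibly unbounded action -/

section Block

variable {X : Type*} [MeasurableSpace X] (μ : Measure X)

/-- For `S ≥ 0` and `Re w ≥ 0` the Boltzmann integrand `f·e^{−wS}` is dominated by `‖f‖`, hence integrable when `f` is.
[folklore] -/
theorem integrable_boltzmann_of_nonneg {f : X → ℂ} (hf : Integrable f μ) {S : X → ℝ} (hS : Measurable S)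
    (hS0 : ∀ x, 0 ≤ S x) {w : ℂ} (hw : 0 ≤ w.re) : Integrable (fun x => f x * cexp (-(w * S x))) μ := by
  refine Integrable.mono' hf.norm (aestronglyMeasurable_boltzmann μ hf.aestronglyMeasurable hS w)
    (Filter.Eventually.of_forall fun x => ?_)
  rw [norm_mul, norm_cexp_neg_mul_ofReal]
  refine mul_le_of_le_one_right (norm_nonneg _) ?_
  rw [Real.exp_le_one_iff]
  have : 0 ≤ w.re * S x := mul_nonneg hw (hS0 x)
  linarith

omit [MeasurableSpace X] in
/-- Pointwise domination of the derivative integrand on the half-plane `Re w ≥ ρ > 0` for `S ≥ 0`: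
`‖f·(−S)·e^{−wS}‖ ≤ ‖f‖·(e·ρ)⁻¹` (the insertion weight `S·e^{−ρS} ≤ (eρ)⁻¹` of route P3). [folklore] -/
theorem norm_insertion_integrand_le_of_re_ge {f : X → ℂ} {S : X → ℝ} (hS0 : ∀ x, 0 ≤ S x) {ρ : ℝ} (hρ : 0 < ρ)
    {w : ℂ} (hw : ρ ≤ w.re) (x : X) :
    ‖f x * (-(S x : ℂ) * cexp (-(w * S x)))‖ ≤ ‖f x‖ * (Real.exp 1 * ρ)⁻¹ := by
  rw [norm_mul, norm_mul, norm_neg, Complex.norm_real, norm_cexp_neg_mul_ofReal, Real.norm_of_nonneg (hS0 x)]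
  refine mul_le_mul_of_nonneg_left ?_ (norm_nonneg _)
  calc S x * Real.exp (-(w.re * S x)) ≤ S x * Real.exp (-(ρ * S x)) := by
        refine mul_le_mul_of_nonneg_left (Real.exp_le_exp.2 ?_) (hS0 x)
        have := mul_le_mul_of_nonneg_right hw (hS0 x)
        linarith
    _ ≤ (Real.exp 1 * ρ)⁻¹ := mul_exp_neg_mul_le hρ (S x)

/-- **HOLOMORPHY ON THE RIGHT HALF-PLANE, UNBOUNDED NONNEGATIVE ACTION** (differentiation under the integral sign,
Mathlib `hasDerivAt_integral_of_dominated_loc_of_deriv_le`, dominating function `‖f‖·(e·Re w₀∕2)⁻¹` on the ball of radius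
`Re w₀ ∕ 2` about `w₀`): `I′(w₀) = ∫ f·(−S)·e^{−w₀S} dμ` for `0 < Re w₀`, from `Integrable f`, `S ≥ 0` measurable — NO bound
on `S` (compare the tree's `T4ComplexDilation.hasDerivAt_blockInt`: every `w₀`, but `|S| ≤ S₀`). [folklore] -/
theorem hasDerivAt_blockInt_of_nonneg {f : X → ℂ} (hf : Integrable f μ) {S : X → ℝ} (hS : Measurable S)
    (hS0 : ∀ x, 0 ≤ S x) {w₀ : ℂ} (hw₀ : 0 < w₀.re) :
    HasDerivAt (blockInt μ f S) (∫ x, f x * (-(S x : ℂ) * cexp (-(w₀ * S x))) ∂μ) w₀ := by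
  have hρ0 : 0 < w₀.re / 2 := half_pos hw₀
  have hF_meas : ∀ᶠ w in nhds w₀, AEStronglyMeasurable (fun x => f x * cexp (-(w * S x))) μ :=
    Filter.Eventually.of_forall fun w => aestronglyMeasurable_boltzmann μ hf.aestronglyMeasurable hS w
  have hF_int : Integrable (fun x => f x * cexp (-(w₀ * S x))) μ :=
    integrable_boltzmann_of_nonneg μ hf hS hS0 hw₀.le
  have hF'_meas : AEStronglyMeasurable (fun x => f x * (-(S x : ℂ) * cexp (-(w₀ * S x)))) μ := by
    refine hf.aestronglyMeasurable.mul ?_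
    have hc : Continuous fun a : ℝ => -(a : ℂ) * cexp (-(w₀ * (a : ℂ))) := by fun_prop
    exact (hc.measurable.comp hS).aestronglyMeasurable
  have h_bound : ∀ᵐ x ∂μ, ∀ w ∈ Metric.ball w₀ (w₀.re / 2),
      ‖f x * (-(S x : ℂ) * cexp (-(w * S x)))‖ ≤ ‖f x‖ * (Real.exp 1 * (w₀.re / 2))⁻¹ := by
    refine Filter.Eventually.of_forall fun x w hw => norm_insertion_integrand_le_of_re_ge hS0 hρ0 ?_ x
    have h := mem_ball_iff_norm.1 hw
    have h2 : |(w - w₀).re| ≤ ‖w - w₀‖ := Complex.abs_re_le_norm (w - w₀)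
    have h3 : |w.re - w₀.re| < w₀.re / 2 := by
      rw [← Complex.sub_re]
      exact h2.trans_lt h
    have h4 := (abs_lt.1 h3).1
    linarith
  have bound_integrable : Integrable (fun x => ‖f x‖ * (Real.exp 1 * (w₀.re / 2))⁻¹) μ := hf.norm.mul_const _
  have h_diff : ∀ᵐ x ∂μ, ∀ w ∈ Metric.ball w₀ (w₀.re / 2),
      HasDerivAt (fun w => f x * cexp (-(w * S x))) (f x * (-(S x : ℂ) * cexp (-(w * S x)))) w := by
    refine Filter.Eventually.of_forall fun x w _ => ?_
    have h1 : HasDerivAt (fun w : ℂ => -(w * (S x : ℂ))) (-(1 * (S x : ℂ))) w :=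
      ((hasDerivAt_id w).mul_const (S x : ℂ)).neg
    have h2 := (h1.cexp).const_mul (f x)
    rw [show f x * (-(S x : ℂ) * cexp (-(w * S x))) = f x * (cexp (-(w * S x)) * -(1 * (S x : ℂ))) by ring]
    exact h2
  exact (hasDerivAt_integral_of_dominated_loc_of_deriv_le (Metric.ball_mem_nhds w₀ hρ0)
    hF_meas hF_int hF'_meas h_bound bound_integrable h_diff).2

/-- The block integral of a nonnegative (possibly unbounded) action is HOLOMORPHIC ON THE OPEN RIGHT HALF-PLANE. [folklore] -/
theorem differentiableOn_blockInt_of_nonneg {f : X → ℂ} (hf : Integrable f μ) {S : X → ℝ} (hS : Measurable S)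
    (hS0 : ∀ x, 0 ≤ S x) : DifferentiableOn ℂ (blockInt μ f S) {w | 0 < w.re} :=
  fun _ hw => (hasDerivAt_blockInt_of_nonneg μ hf hS hS0 hw).differentiableAt.differentiableWithinAt

/-- **REAL DERIVATIVE = INSERTION, unbounded nonnegative action**: for `r > 0`, `r ↦ ∫ f e^{−rS} dμ` has derivative
`NE9BirthInsertion.insertion μ f S r = ∫ f·(−S)·e^{−rS} dμ` (route P3's `hasDerivAt_blockInt_real` without `hS₀`, at the
price `r > 0` — which every consumer has). [folklore] -/
theorem hasDerivAt_blockInt_real_of_nonneg {f : X → ℂ} (hf : Integrable f μ) {S : X → ℝ} (hS : Measurable S)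
    (hS0 : ∀ x, 0 ≤ S x) {r : ℝ} (hr : 0 < r) :
    HasDerivAt (fun r : ℝ => blockInt μ f S (r : ℂ)) (insertion μ f S r) r :=
  (hasDerivAt_blockInt_of_nonneg μ hf hS hS0 (w₀ := (r : ℂ)) (by simpa using hr)).comp_ofReal

/-- **LOG-CURRENCY, unbounded nonnegative action**: `u ↦ ∫ f e^{−e^u S} dμ` has derivative `e^u·(insertion at e^u)` at
EVERY `u` (route P3's `hasDerivAt_blockInt_log` without `hS₀`; `e^u > 0` supplies the positivity). [folklore] -/
theorem hasDerivAt_blockInt_log_of_nonneg {f : X → ℂ} (hf : Integrable f μ) {S : X → ℝ} (hS : Measurable S)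
    (hS0 : ∀ x, 0 ≤ S x) (u : ℝ) :
    HasDerivAt (fun u : ℝ => blockInt μ f S (Real.exp u : ℂ))
      ((Real.exp u : ℂ) * insertion μ f S (Real.exp u)) u := by
  have h1 := hasDerivAt_blockInt_real_of_nonneg μ hf hS hS0 (Real.exp_pos u)
  have h2 : HasDerivAt (fun u : ℝ => Real.exp u) (Real.exp u) u := Real.hasDerivAt_exp u
  have h := h1.scomp u h2
  rw [show ((Real.exp u : ℝ) : ℂ) * insertion μ f S (Real.exp u) = Real.exp u • insertion μ f S (Real.exp u) from
    (Complex.real_smul).symm]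
  exact h

end Block

/-! ## §2 Face (i): the complex-dilation statements of `T4ComplexDilation` without the bounded-action binder -/

section Model

variable {ι : Type*} [Fintype ι] [DecidableEq ι] {X : Type*} [MeasurableSpace X]

/-- The model activity `act = invNorm·blockInt` is holomorphic on the right half-plane — `S ≥ 0` unbounded
(`T4ComplexDilation.differentiableOn_act` without `hS₀`). [folklore] -/
theorem differentiableOn_act_of_nonneg (A : Matrix ι ι ℝ) {μ : Measure X} {f : X → ℂ} (hf : Integrable f μ)
    {S : X → ℝ} (hS : Measurable S) (hS0 : ∀ x, 0 ≤ S x) : DifferentiableOn ℂ (act A μ f S) {z | 0 < z.re} :=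
  (differentiableOn_invNorm A).mul (differentiableOn_blockInt_of_nonneg μ hf hS hS0)

/-- **DILATION-ANALYTICITY of the model activity, unbounded nonnegative action** — the statement of
`T4ComplexDilation.act_dilationAnalytic` (the `hlast` shape: holomorphic on a set containing every dilation disc
`|z − s| ≤ c·s`, `s ≥ t₀`, bounded there by `dilVol c n · M` when `absAct ≤ M` on the dilated real range) with `hS₀` replaced
by `S ≥ 0`; proof verbatim, holomorphy from §1. [folklore] -/
theorem act_dilationAnalytic_of_nonneg (A : Matrix ι ι ℝ) (hA : A.PosDef) {μ : Measure X} {f : X → ℂ}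
    (hf : Integrable f μ) {S : X → ℝ} (hS : Measurable S) (hS0 : ∀ x, 0 ≤ S x) {t₀ c M : ℝ} (ht₀ : 0 < t₀)
    (hc0 : 0 ≤ c) (hc : c < 1) (hM : ∀ r : ℝ, (1 - c) * t₀ ≤ r → absAct A μ f S r ≤ M) :
    ∃ D : Set ℂ, DifferentiableOn ℂ (act A μ f S) D ∧
      (∀ z ∈ D, ‖act A μ f S z‖ ≤ dilVol c (Fintype.card ι) * M) ∧
      ∀ s ∈ Set.Ici t₀, closedBall (s : ℂ) (c * s) ⊆ D := by
  have hc2 : c ^ 2 < 1 := by nlinarith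
  refine ⟨dilDom t₀ c, (differentiableOn_act_of_nonneg A hf hS hS0).mono (dilDom_subset_re_pos ht₀ hc), ?_,
    fun s hs => closedBall_subset_dilDom hs⟩
  rintro z ⟨s, hs, hz⟩
  have hre : 0 < z.re := re_pos_of_mem_dilDisc ht₀ hc hs hz
  have hzc := normSq_mul_le_re_sq_of_mem_dilDisc hz
  refine (norm_act_le A hA μ f S hre hc2 hzc).trans (mul_le_mul_of_nonneg_left (hM _ ?_) (dilVol_nonneg _ _))
  calc (1 - c) * t₀ ≤ (1 - c) * s := mul_le_mul_of_nonneg_left hs (by linarith)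
    _ ≤ z.re := re_ge_of_mem_dilDisc hz

/-- **CAUCHY ⇒ LIPSCHITZ IN THE REAL COUPLING, unbounded nonnegative action** — the statement of
`T4ComplexDilation.act_lipschitz` with `hS₀` replaced by `S ≥ 0`: `‖G(s) − G(s′)‖ ≤ (4·dilVol c n·M∕(c·t₀))·|s − s′|` for
`s, s′ ≥ t₀` (`Dimock2015.real_param_lipschitz` BY NAME on the discs of radius `c·t₀`). [folklore] -/
theorem act_lipschitz_of_nonneg (A : Matrix ι ι ℝ) (hA : A.PosDef) {μ : Measure X} {f : X → ℂ} (hf : Integrable f μ)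
    {S : X → ℝ} (hS : Measurable S) (hS0 : ∀ x, 0 ≤ S x) {t₀ c M : ℝ} (ht₀ : 0 < t₀) (hc0 : 0 < c) (hc : c < 1)
    (hM : ∀ r : ℝ, (1 - c) * t₀ ≤ r → absAct A μ f S r ≤ M) {s s' : ℝ} (hs : t₀ ≤ s) (hs' : t₀ ≤ s') :
    ‖act A μ f S s - act A μ f S s'‖ ≤ 4 * (dilVol c (Fintype.card ι) * M) / (c * t₀) * |s - s'| := by
  obtain ⟨D, hD, hB, hdisc⟩ := act_dilationAnalytic_of_nonneg A hA hf hS hS0 ht₀ hc0.le hc hM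
  have hDab : ∀ u ∈ Icc (min s s') (max s s'), closedBall (u : ℂ) (c * t₀) ⊆ D := by
    intro u hu
    have hut : t₀ ≤ u := (le_min hs hs').trans hu.1
    exact (closedBall_subset_closedBall (mul_le_mul_of_nonneg_left hut hc0.le)).trans (hdisc u hut)
  exact Literature.MathematicalPhysics.QuantumFieldTheory.Dimock2015.real_param_lipschitz (mul_pos hc0 ht₀) hD hB
    hDab ⟨min_le_left _ _, le_max_left _ _⟩ ⟨min_le_right _ _, le_max_right _ _⟩

/-- **`hlast` INHABITED BY A GENUINE INTEGRAL, unbounded nonnegative action** — the statement of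
`T4ComplexDilation.stepTransfer_modelV` with `hS₀` replaced by `S ≥ 0`: the memoryless model hierarchy `modelV` satisfies the
lineage's `StepTransfer` on the box window `[t₀, ∞[` with last-coupling constant `4·dilVol c n·M∕(c·t₀)`
(`T4CouplingAnalyticity.stepTransfer_of_analyticOn` BY NAME). [folklore] -/
theorem stepTransfer_modelV_of_nonneg (A : Matrix ι ι ℝ) (hA : A.PosDef) {μ : Measure X} {f : X → ℂ}
    (hf : Integrable f μ) {S : X → ℝ} (hS : Measurable S) (hS0 : ∀ x, 0 ≤ S x) {t₀ c M : ℝ} (ht₀ : 0 < t₀)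
    (hc0 : 0 < c) (hc : c < 1) (hM : ∀ r : ℝ, (1 - c) * t₀ ≤ r → absAct A μ f S r ≤ M) :
    StepTransfer (modelV A μ f S) (BoxWindow (Set.Ici t₀)) (4 * (dilVol c (Fintype.card ι) * M) / (c * t₀))
      (4 * (dilVol c (Fintype.card ι) * M) / 1) 0 := by
  obtain ⟨D, hD, hB, hdisc⟩ := act_dilationAnalytic_of_nonneg A hA hf hS hS0 ht₀ hc0.le hc hM
  refine stepTransfer_of_analyticOn (V := modelV A μ f S) Set.ordConnected_Ici (fun _ _ => (0 : ℂ))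
    (fun _ z _ => act A μ f S z) (fun s => c * s) (mul_pos hc0 ht₀)
    (fun s hs => mul_le_mul_of_nonneg_left (Set.mem_Ici.1 hs) hc0.le) one_pos ?_ ?_ ?_ ?_
  · intro j g _
    rfl
  · intro j g _
    exact ⟨D, hD, hB, hdisc⟩
  · intro j s hs
    exact ⟨Set.univ, differentiableOn_const _,
      fun w _ => hB _ (hdisc s hs (mem_closedBall_self (mul_nonneg hc0.le (ht₀.le.trans (Set.mem_Ici.1 hs))))),
      fun g _ => Set.subset_univ _⟩
  · intro j g _ g' _
    simp only [sub_self, norm_zero]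
    exact Finset.sum_nonneg fun m _ => mul_nonneg (pow_nonneg le_rfl _) (norm_nonneg _)

end Model

/-! ## §3 Face (iv): route P3's real-normalised activity and coupling two-point clause without the bounded-action binder -/

section Birth

variable {ι : Type*} [Fintype ι] [DecidableEq ι] {X : Type*} [MeasurableSpace X]

/-- The derivative of the real-normalised activity `actR` at `r > 0` — `NE9BirthCouplingTwoPoint.hasDerivAt_actR` with `hS₀`
replaced by `S ≥ 0` (product rule: `hasDerivAt_realNorm` × §1). [folklore] -/
theorem hasDerivAt_actR_of_nonneg (A : Matrix ι ι ℝ) (hA : A.PosDef) {μ : Measure X} {f : X → ℂ}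
    (hf : Integrable f μ) {S : X → ℝ} (hS : Measurable S) (hS0 : ∀ x, 0 ≤ S x) {r : ℝ} (hr : 0 < r) :
    HasDerivAt (actR A μ f S)
      ((((Fintype.card ι : ℝ) / (2 * r) * realNorm A r : ℝ) : ℂ) * blockInt μ f S (r : ℂ) +
        (realNorm A r : ℂ) * insertion μ f S r) r := by
  have h1 : HasDerivAt (fun s : ℝ => (realNorm A s : ℂ))
      ((((Fintype.card ι : ℝ) / (2 * r) * realNorm A r : ℝ) : ℂ)) r :=
    (hasDerivAt_realNorm A hA hr).ofReal_comp
  exact h1.mul (hasDerivAt_blockInt_real_of_nonneg μ hf hS hS0 hr)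

/-- **COUPLING TWO-POINT FROM THE INSERTION BOUND, unbounded nonnegative action** — the statement of
`NE9BirthCouplingTwoPoint.couplingTwoPoint_of_insertion` with the binder `hS₀` DELETED (it already assumes `S ≥ 0`): if
`absAct(r) ≤ N` for `r ≥ (1−θ)t₀` then for all `t, t′ ≥ t₀`, `‖actR(t)‖ ≤ N` and
`‖actR(t) − actR(t′)‖ ≤ (K(θ,n)∕t₀)·N·|t − t′|`, `K = birthConst`.  Proof verbatim from route P3 (mean value theorem on the
convex ray `[t₀, ∞)` against `norm_mul_deriv_actR_le`), with the derivative supplied by `hasDerivAt_actR_of_nonneg`.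
[folklore] -/
theorem couplingTwoPoint_of_insertion_of_nonneg (A : Matrix ι ι ℝ) (hA : A.PosDef) {μ : Measure X} {f : X → ℂ}
    (hf : Integrable f μ) {S : X → ℝ} (hSm : Measurable S) (hS : ∀ x, 0 ≤ S x)
    {θ : ℝ} (hθ : 0 < θ) (hθ1 : θ < 1) {t₀ : ℝ} (ht₀ : 0 < t₀) {N : ℝ}
    (habs : ∀ r, (1 - θ) * t₀ ≤ r → absAct A μ f S r ≤ N) {t t' : ℝ} (ht : t₀ ≤ t) (ht' : t₀ ≤ t') :
    ‖actR A μ f S t‖ ≤ N ∧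
      ‖actR A μ f S t - actR A μ f S t'‖ ≤ birthConst θ (Fintype.card ι) / t₀ * N * |t - t'| := by
  set n := Fintype.card ι
  have hdil : ∀ {r}, t₀ ≤ r → (1 - θ) * t₀ ≤ r := fun {r} hr => by nlinarith
  have hN : 0 ≤ N := (absAct_nonneg A μ f S t).trans (habs t (hdil ht))
  refine ⟨(norm_actR_le A μ f S t).trans (habs t (hdil ht)), ?_⟩
  -- derivative bound on the ray (the ONLY change w.r.t. route P3: the derivative needs `r > 0`, not `|S| ≤ S₀`)
  have hderiv : ∀ r ∈ Ici t₀, HasDerivWithinAt (actR A μ f S)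
      ((((n : ℝ) / (2 * r) * realNorm A r : ℝ) : ℂ) * blockInt μ f S (r : ℂ) +
        (realNorm A r : ℂ) * insertion μ f S r) (Ici t₀) r := fun r hr =>
    (hasDerivAt_actR_of_nonneg A hA hf hSm hS (ht₀.trans_le hr)).hasDerivWithinAt
  have hbound : ∀ r ∈ Ici t₀, ‖(((n : ℝ) / (2 * r) * realNorm A r : ℝ) : ℂ) * blockInt μ f S (r : ℂ) +
      (realNorm A r : ℂ) * insertion μ f S r‖ ≤ birthConst θ n / t₀ * N := by
    intro r hr
    have hr0 : 0 < r := ht₀.trans_le hr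
    have h := norm_mul_deriv_actR_le A hA hf hSm hS hθ hθ1 hr0
    rw [norm_mul, Complex.norm_real, Real.norm_of_nonneg hr0.le] at h
    have h1 : absAct A μ f S r ≤ N := habs r (hdil hr)
    have h2 : absAct A μ f S ((1 - θ) * r) ≤ N :=
      habs _ (mul_le_mul_of_nonneg_left (mem_Ici.1 hr) (by linarith))
    have hK : (n : ℝ) / 2 * absAct A μ f S r +
        (Real.exp 1 * θ)⁻¹ * Real.sqrt (((1 - θ) ^ n)⁻¹) * absAct A μ f S ((1 - θ) * r) ≤ birthConst θ n * N := by
      have hC : 0 ≤ (Real.exp 1 * θ)⁻¹ * Real.sqrt (((1 - θ) ^ n)⁻¹) := by positivity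
      have hn0 : (0 : ℝ) ≤ (n : ℝ) / 2 := by positivity
      calc (n : ℝ) / 2 * absAct A μ f S r +
            (Real.exp 1 * θ)⁻¹ * Real.sqrt (((1 - θ) ^ n)⁻¹) * absAct A μ f S ((1 - θ) * r)
          ≤ (n : ℝ) / 2 * N + (Real.exp 1 * θ)⁻¹ * Real.sqrt (((1 - θ) ^ n)⁻¹) * N :=
            add_le_add (mul_le_mul_of_nonneg_left h1 hn0) (mul_le_mul_of_nonneg_left h2 hC)
        _ = birthConst θ n * N := by unfold birthConst; ring
    have hD : ‖(((n : ℝ) / (2 * r) * realNorm A r : ℝ) : ℂ) * blockInt μ f S (r : ℂ) +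
        (realNorm A r : ℂ) * insertion μ f S r‖ ≤ birthConst θ n * N / r := by
      rw [le_div_iff₀ hr0, mul_comm]
      exact h.trans hK
    refine hD.trans ?_
    rw [div_mul_eq_mul_div]
    exact div_le_div_of_nonneg_left (mul_nonneg (birthConst_nonneg hθ n) hN) ht₀ hr
  have key := (convex_Ici t₀).norm_image_sub_le_of_norm_hasDerivWithin_le hderiv hbound
    (mem_Ici.2 ht') (mem_Ici.2 ht)
  rwa [Real.norm_eq_abs] at key

end Birth

/-! ## §4 The junction in the owner's binder shape without the bounded-action binder -/

section Junction

variable {C : Carriers} (G : ClusterGeom C) {Bg : Type} {Pot : Type*} {X' : Type*} [MeasurableSpace X']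

/-- **`hCup` FROM THE INSERTION STRUCTURE, UNBOUNDED NONNEGATIVE ACTION (kernel; (L)-supplier (iv) in the owner's binder
shape, referee DV-3 discharged).**  The statement of `NE9BirthCouplingJunction.hCup_of_insertion` with the hypothesis
`hS₀ : ∀ k U γ, ∃ S₀, ∀ x, |S k U γ x| ≤ S₀` DELETED and nothing added: blocks positive definite, densities integrable on the
admissible configurations, `S` measurable and nonnegative, window couplings `≥ t₀ > 0`, `0 < θ < 1`, `absAct ≤ N₀ k U γ`
for all couplings `r ≥ (1−θ)t₀` and all admissible `Q` ⇒ literally the COUPLING TWO-POINT clause of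
`NE9LastCouplingBridge.norm_newTerm_sub_le_of_couplingTwoPoint` for `act := insAct G nv A μ f S`,
`n := insMajorant G θ nv N₀`, `clip := fun _ => t₀⁻¹`.  Proof verbatim from route P3 with §3 as the supplier. [folklore] -/
theorem hCup_of_insertion_of_nonneg {W : Set (ℕ → ℝ)} {𝒜 : ℕ → Set Pot} {t₀ θ : ℝ} (ht₀ : 0 < t₀) (hθ : 0 < θ)
    (hθ1 : θ < 1) (hW : ∀ g ∈ W, ∀ k, t₀ ≤ g k) {nv : ℕ → Bg → G.P → ℕ}
    {A : (k : ℕ) → (U : Bg) → (γ : G.P) → Matrix (Fin (nv k U γ)) (Fin (nv k U γ)) ℝ}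
    {μ : ℕ → Bg → G.P → Measure X'} {f : ℕ → Bg → Pot → G.P → X' → ℂ} {S : ℕ → Bg → G.P → X' → ℝ}
    (hA : ∀ k U γ, (A k U γ).PosDef) (hf : ∀ k U γ, ∀ Q ∈ 𝒜 k, Integrable (f k U Q γ) (μ k U γ))
    (hSm : ∀ k U γ, Measurable (S k U γ)) (hS : ∀ k U γ x, 0 ≤ S k U γ x) {N₀ : ℕ → Bg → G.P → ℝ}
    (habs : ∀ k U γ, ∀ Q ∈ 𝒜 k, ∀ r, (1 - θ) * t₀ ≤ r →
      absAct (A k U γ) (μ k U γ) (f k U Q γ) (S k U γ) r ≤ N₀ k U γ) :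
    ∀ g ∈ W, ∀ g' ∈ W, ∀ (k : ℕ) (U : Bg) (X : C.Dom), C.scale X = k + 1 → ∀ Q ∈ 𝒜 k, ∀ γ ∈ G.vol X,
      ‖insAct G nv A μ f S k (g k) U Q γ‖ ≤ insMajorant G θ nv N₀ k (g' k) U γ ∧
        ‖insAct G nv A μ f S k (g k) U Q γ - insAct G nv A μ f S k (g' k) U Q γ‖ ≤
          t₀⁻¹ * |g k - g' k| * insMajorant G θ nv N₀ k (g' k) U γ := by
  intro g hg g' hg' k U X _ Q hQ γ _
  have key := couplingTwoPoint_of_insertion_of_nonneg (A k U γ) (hA k U γ) (hf k U γ Q hQ) (hSm k U γ) (hS k U γ)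
    hθ hθ1 ht₀ (habs k U γ Q hQ) (hW g hg k) (hW g' hg' k)
  obtain ⟨hsize, htwo⟩ := key
  -- `N₀ ≥ 0` (it dominates a nonnegative functional) and `1 ≤ max 1 K`
  have hN₀ : 0 ≤ N₀ k U γ :=
    (absAct_nonneg _ _ _ _ _).trans (habs k U γ Q hQ (g k) (by nlinarith [hW g hg k]))
  have hmax1 : 1 ≤ max 1 (birthConst θ (nv k U γ)) := le_max_left _ _
  have hmaxK : birthConst θ (nv k U γ) ≤ max 1 (birthConst θ (nv k U γ)) := le_max_right _ _
  have hcard : Fintype.card (Fin (nv k U γ)) = nv k U γ := Fintype.card_fin _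
  refine ⟨?_, ?_⟩
  · -- size: ‖act‖ ≤ N₀ ≤ max(1,K)·N₀
    calc ‖insAct G nv A μ f S k (g k) U Q γ‖ ≤ N₀ k U γ := hsize
      _ = 1 * N₀ k U γ := (one_mul _).symm
      _ ≤ max 1 (birthConst θ (nv k U γ)) * N₀ k U γ := mul_le_mul_of_nonneg_right hmax1 hN₀
  · -- two-point: (K/t₀)·N₀·|Δ| ≤ t₀⁻¹·|Δ|·(max(1,K)·N₀)
    rw [hcard] at htwo
    calc ‖insAct G nv A μ f S k (g k) U Q γ - insAct G nv A μ f S k (g' k) U Q γ‖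
        ≤ birthConst θ (nv k U γ) / t₀ * N₀ k U γ * |g k - g' k| := htwo
      _ ≤ max 1 (birthConst θ (nv k U γ)) / t₀ * N₀ k U γ * |g k - g' k| := by
          have : birthConst θ (nv k U γ) / t₀ ≤ max 1 (birthConst θ (nv k U γ)) / t₀ :=
            div_le_div_of_nonneg_right hmaxK ht₀.le
          exact mul_le_mul_of_nonneg_right (mul_le_mul_of_nonneg_right this hN₀) (abs_nonneg _)
      _ = t₀⁻¹ * |g k - g' k| * (max 1 (birthConst θ (nv k U γ)) * N₀ k U γ) := by ring

end Junction

/-! ## §5 Non-vacuity: an unbounded nonnegative action to which §1–§4 apply and the tree's bounded lemmas do not -/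

section Witness

/-- The identity action `S x = x` on `[0, ∞)` (Lebesgue measure restricted to `Ici 0`) is measurable, nonnegative on the
support and UNBOUNDED: no `S₀` with `∀ x, |S x| ≤ S₀` exists for `S = fun x : ℝ => max x 0`. [folklore] -/
theorem not_bounded_max_id : ¬ ∃ S₀ : ℝ, ∀ x : ℝ, |max x 0| ≤ S₀ := by
  rintro ⟨S₀, h⟩
  have h1 := h (|S₀| + 1)
  have h2 : max (|S₀| + 1) 0 = |S₀| + 1 := max_eq_left (by positivity)
  rw [h2, abs_of_nonneg (by positivity)] at h1
  have := le_abs_self S₀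
  linarith

/-- … while `max x 0 ≥ 0` is measurable, so §1 applies to it with any integrable density: e.g. the block integral
`w ↦ ∫ f·e^{−w·max(x,0)} dμ` is holomorphic on the right half-plane for every finite measure `μ` on `ℝ` and every
`f ∈ L¹(μ)`. [folklore] -/
example (μ : Measure ℝ) {f : ℝ → ℂ} (hf : Integrable f μ) :
    DifferentiableOn ℂ (blockInt μ f (fun x => max x 0)) {w | 0 < w.re} :=
  differentiableOn_blockInt_of_nonneg μ hf (measurable_id.max measurable_const) (fun x => le_max_right x 0)

end Witness

end Summit.QuantumFields.BalabanUV.T4Continuum.NE9BirthInsertionUnbounded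

end
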